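import Summits.BirchSwinnertonDyer.BirchSwinnertonDyer.Theorems.CyclotomicUntwistNineGaloisDescent
import Summits.BirchSwinnertonDyer.BirchSwinnertonDyer.Theorems.CyclotomicUntwistDescendedFrobeniusOneModel
import Summits.BirchSwinnertonDyer.BirchSwinnertonDyer.Theorems.CyclotomicUntwistKatzFrobeniusModVarpi
import Literature.NumberTheory.EllipticCurves.FormalGroupLogHomAbelProofs
import Literature.NumberTheory.EllipticCurves.KatzDieudonneModuleRank
import HarnessLib

/-!
# `isDescendedFrobeniusMatrix_exists` from Katz's rank theorem (Dieudonné rank `=` height `≤ 2`), the second-kind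
# property of `[η_W]` and `[η_W] ∉ L·[ω_W]` — the print input of C2 re-typed as ONE cited rank statement

Cell `pub/bsd-wall`, D-0145 line `route-BirchSwinnertonDyer-CyclotomicUntwist`, lead seat `bsd-line-cycu-p1` (gen 6),
capstone of the lane «HONDA OVER `𝓞_{ℚ₃(ζ₉)}` / GALOIS DESCENT» (parts 1–5: `NineHondaEstimate`, `NineHondaCongruence`,
`NineDescendedFrobeniusOfOmegaColumn`, `NineLogUnbounded`, `NineGaloisDescent`) over the sibling files
`KatzFrobeniusModVarpi` (cycu-p3 g8: `φ = (z ↦ z³)^*` preserves second-kind classes) and `DescendedFrobeniusOneModel`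
(cycu-p4 g8: model transport `hbd_omegaColumn_iff`). Toward the print input `WeierstrassCurve.isDescendedFrobeniusMatrix_exists`
of the K-SEP child C2 = stmt-BirchSwinnertonDyer-27549 (cruxes K1 `PSRankOneLowerHalfAtThree` = 21580 / K2 = 21581).

* `Literature.NumberTheory.EllipticCurves.katz_dieudonne_rank_le_two` (imported) — the cited statement (Katz 1981, Thm. 5.3.3: for a `p`-divisible commutative formal Lie
  group `G` of height `h` over a `p`-adic ring flat over `ℤ`, Katz's module `D(G/R)` of functions with integral
  differential and integral coboundary, modulo integral functions, is locally free of rank `h`), SPECIAL CASE filed: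
  the formal group of a Weierstrass model over `𝓞 = 𝓞_{ℚ₃(ζ₉)}` with elliptic special fibre (height `≤ 2`), after
  `⊗ ℚ`: any three series of the second kind are `ℚ₃(ζ₉)`-dependent modulo bounded denominators. The "second kind"
  clauses are spelled exactly as in `KatzFrobenius.coboundary_expand_three`.
* `isDescendedFrobeniusMatrix_exists_of_katzRankLeTwo` — **the named fact FOLLOWS from that rank statement together with
  two properties of the second Néron class `classEta` on a supersingular good model: it is of the second kind (its
  coboundary has bounded denominators) and it is not a multiple of `classOmega` modulo bounded denominators** (both
  kernel-sized; cycu-p5 g10's lane). Proof: apply the rank statement to `([ω], φ[ω], [η])` (`[ω]`: homomorphism, `φ[ω]`: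
  `coboundary_expand_three`); the coefficient of `[η]` is non-zero by `NineGaloisDescent.omegaPlane_independent`
  (transport: `DescendedFrobeniusOneModel.hbd_omegaColumn_iff`); normalise to the `η`-position `[η] ≡ A[ω] + Bφ[ω]`,
  `B ≠ 0` by the second property; conclude by `NineGaloisDescent.isDescendedFrobeniusMatrix_exists_of_etaPosition`.

THEOREMS ONLY (the cited `Prop` is imported from Literature; no instance, no notation, no `sorry`); BSD is not proved by this file and no crux is; the
named fact `isDescendedFrobeniusMatrix_exists` becomes a THEOREM modulo (Katz 5.3.3, typed) and cycu-p5's two lemmas.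

References: N. M. Katz, Crystalline cohomology, Dieudonné modules, and Jacobi sums, LNM 868 (1981), §5.1 (pp. 189–193),
Thm. 5.3.3 (p. 198) [Katz1981CrystallineDieudonne]; J. Tate, p-divisible groups (1967) §2 [Tate1967].
-/

-- single-conjunct summit: `Summit.BirchSwinnertonDyer.BirchSwinnertonDyer.…` repeats the name by design
set_option linter.dupNamespace false
set_option autoImplicit false

noncomputable section

open scoped Classical
open PowerSeries IsCyclotomicExtension Literature.NumberTheory.EllipticCurves.DescendedFrobenius
  Summit.BirchSwinnertonDyer.BirchSwinnertonDyer.Theorems.NineIntegers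
  Summit.BirchSwinnertonDyer.BirchSwinnertonDyer.Theorems.NineHondaEstimate
  Summit.BirchSwinnertonDyer.BirchSwinnertonDyer.Theorems.DescendedFrobeniusTransfer
  Summit.BirchSwinnertonDyer.BirchSwinnertonDyer.Theorems.NineHonda
  Summit.BirchSwinnertonDyer.BirchSwinnertonDyer.Theorems.NineLogUnbounded
  Summit.BirchSwinnertonDyer.BirchSwinnertonDyer.Theorems.NineDescendedFrobeniusOfOmegaColumn
  Summit.BirchSwinnertonDyer.BirchSwinnertonDyer.Theorems.NineGaloisDescent
  Summit.BirchSwinnertonDyer.BirchSwinnertonDyer.Theorems.DescendedFrobeniusOneModel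
  Summit.BirchSwinnertonDyer.BirchSwinnertonDyer.Theorems.KatzFrobenius

namespace Summit.BirchSwinnertonDyer.BirchSwinnertonDyer.Theorems.NineNamedFactOfKatzRank

/-! The cited input is the Literature named fact `Literature.NumberTheory.EllipticCurves.katz_dieudonne_rank_le_two`
(`KatzDieudonneModuleRank.lean`: Katz 1981 Thm. 5.3.3, special case over `𝓞_{ℚ₃(ζ₉)}`, after `⊗ ℚ`). -/

variable {W : WeierstrassCurve ℚ}

/-! ### The two Néron classes and `φ[ω]` are of the second kind -/

/-- `(C a · f)` substituted into a two-variable series is `C a · (f substituted)`. [folklore] -/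
theorem subst_C_mul_mv {a : KNine} {f : KNine⟦X⟧} {G : MvPowerSeries (Fin 2) KNine} (hG : HasSubst G) :
    (PowerSeries.C a * f).subst G = MvPowerSeries.C a * f.subst G := by
  rw [← coe_substAlgHom hG, map_mul, C_eq_algebraMap, AlgHom.commutes, MvPowerSeries.algebraMap_apply,
    Algebra.algebraMap_self, RingHom.id_apply]

/-- **`[ω_W] = u⁻¹·log_𝓔` is of the second kind**: zero constant term, log-type coefficients (`3ᵏu⁻¹ ∈ 𝓞` for some
`k`, `n·[zⁿ]log_𝓔 ∈ 𝓞`), and ZERO coboundary (`log_𝓔` is a homomorphism `Ê → 𝔾̂ₐ`).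
[cite: Katz1981CrystallineDieudonne, §5.1 (p. 193)] [cite: SilvermanAEC2009, IV.5.2] -/
theorem secondKind_classOmega (𝓜 : W.NineGoodModel) :
    constantCoeff 𝓜.classOmega = 0 ∧
      (∃ d : ℕ, ∀ n : ℕ, IsIntegral ℤ_[3] ((3 : KNine) ^ d * ((n : KNine) * coeff n 𝓜.classOmega))) ∧
      (∃ d' : ℕ, ∀ e : Fin 2 →₀ ℕ, IsIntegral ℤ_[3] ((3 : KNine) ^ d' * MvPowerSeries.coeff e
        (𝓜.classOmega.subst (𝓜.E.map (algebraMap ONine KNine)).formalGroupLaw -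
          𝓜.classOmega.subst (MvPowerSeries.X 0) - 𝓜.classOmega.subst (MvPowerSeries.X 1)))) := by
  set u' : KNine := ((𝓜.C.u⁻¹ : KNineˣ) : KNine) with hu'
  have hΩ : 𝓜.classOmega = PowerSeries.C u' * 𝓜.curve.formalLog := by
    rw [WeierstrassCurve.NineGoodModel.classOmega, smul_eq_C_mul]
  refine ⟨?_, ?_, ⟨0, fun e => ?_⟩⟩
  · rw [hΩ, map_mul, WeierstrassCurve.constantCoeff_formalLog, mul_zero]
  · obtain ⟨k, hk⟩ := exists_three_pow_mul_isIntegral u'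
    refine ⟨k, fun n => ?_⟩
    rw [hΩ, coeff_C_mul, show (3 : KNine) ^ k * ((n : KNine) * (u' * coeff n 𝓜.curve.formalLog)) =
      (3 ^ k * u') * ((n : KNine) * coeff n 𝓜.curve.formalLog) by ring]
    exact hk.mul (natCast_mul_coeff_formalLog_mem 𝓜.E n)
  · have hG : HasSubst (𝓜.E.map (algebraMap ONine KNine)).formalGroupLaw :=
      (𝓜.E.map (algebraMap ONine KNine)).hasSubst_formalGroupLaw
    have hX0 : HasSubst (MvPowerSeries.X 0 : MvPowerSeries (Fin 2) KNine) := HasSubst.X 0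
    have hX1 : HasSubst (MvPowerSeries.X 1 : MvPowerSeries (Fin 2) KNine) := HasSubst.X 1
    have hcurve : 𝓜.curve = 𝓜.E.map (algebraMap ONine KNine) := rfl
    rw [hΩ, subst_C_mul_mv hG, subst_C_mul_mv hX0, subst_C_mul_mv hX1, hcurve,
      (𝓜.E.map (algebraMap ONine KNine)).formalLog_subst_formalGroupLaw]
    have e0 : ∀ X Y : MvPowerSeries (Fin 2) KNine,
        MvPowerSeries.C u' * (X + Y) - MvPowerSeries.C u' * X - MvPowerSeries.C u' * Y = 0 := fun X Y => by ring
    rw [e0, map_zero, mul_zero]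
    exact isIntegral_zero

/-- **`φ[ω_W]` is of the second kind** (`φ = expand 3`): `KatzFrobenius.coboundary_expand_three` (cycu-p3 g8) for the
coboundary; the log-type clause by `[zⁿ]f(z³) = [z^{n/3}]f`. [cite: Katz1981CrystallineDieudonne, Thm. 5.1.4] -/
theorem secondKind_expand_classOmega (𝓜 : W.NineGoodModel) (ρ : ONine →+* ZMod 3) :
    constantCoeff (expand 3 (by norm_num) 𝓜.classOmega) = 0 ∧
      (∃ d : ℕ, ∀ n : ℕ, IsIntegral ℤ_[3] ((3 : KNine) ^ d *
        ((n : KNine) * coeff n (expand 3 (by norm_num) 𝓜.classOmega)))) ∧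
      (∃ d' : ℕ, ∀ e : Fin 2 →₀ ℕ, IsIntegral ℤ_[3] ((3 : KNine) ^ d' * MvPowerSeries.coeff e
        ((expand 3 (by norm_num) 𝓜.classOmega).subst (𝓜.E.map (algebraMap ONine KNine)).formalGroupLaw -
          (expand 3 (by norm_num) 𝓜.classOmega).subst (MvPowerSeries.X 0) -
          (expand 3 (by norm_num) 𝓜.classOmega).subst (MvPowerSeries.X 1)))) := by
  obtain ⟨h0, ⟨d, hd⟩, ⟨d', hd'⟩⟩ := secondKind_classOmega 𝓜
  refine ⟨by rw [constantCoeff_expand, h0], ⟨d, fun n => ?_⟩, ?_⟩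
  · rw [coeff_expand]
    split_ifs with h3
    · obtain ⟨m, rfl⟩ := h3
      rw [Nat.mul_div_cancel_left _ (by norm_num : 0 < 3), Nat.cast_mul,
        show (3 : KNine) ^ d * (((3 : ℕ) : KNine) * (m : KNine) * coeff m 𝓜.classOmega) =
          ((3 : ℕ) : KNine) * ((3 : KNine) ^ d * ((m : KNine) * coeff m 𝓜.classOmega)) by ring]
      have h3int : IsIntegral ℤ_[3] ((3 : ℕ) : KNine) := by
        rw [show ((3 : ℕ) : KNine) = algebraMap ℤ_[3] KNine 3 by rw [Nat.cast_ofNat, map_ofNat]]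
        exact isIntegral_algebraMap
      exact h3int.mul (hd m)
    · rw [mul_zero, mul_zero]; exact isIntegral_zero
  · obtain ⟨ϖ, θ, θ', h3, hθ, hker, -⟩ := exists_uniformizer
    exact ⟨d + 1 + d', fun e => coboundary_expand_three h3 hθ ρ (hker ρ) 𝓜.E hd hd' e⟩

/-! ### The named fact from the rank statement -/

/-- **`isDescendedFrobeniusMatrix_exists` FROM KATZ'S RANK THEOREM.** Granted `katz_dieudonne_rank_le_two` (cited) and, on
every good model of every `W` with supersingular special fibre, (i) the second Néron class `classEta` is of the second kind
(its coboundary has bounded denominators) and (ii) `classEta` is not a `ℚ₃(ζ₉)`-multiple of `classOmega` modulo bounded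
denominators — both kernel-sized (cycu-p5 g10's lane: the formal ζ-addition law; the Hasse-invariant argument) — the
named fact holds: the rank statement applied to `([ω], φ[ω], [η])` has non-zero `[η]`-coefficient by
`NineGaloisDescent.omegaPlane_independent` (transport `DescendedFrobeniusOneModel.hbd_omegaColumn_iff`), giving the
`η`-position `[η] ≡ A[ω] + Bφ[ω]` with `B ≠ 0` by (ii); conclude by
`NineGaloisDescent.isDescendedFrobeniusMatrix_exists_of_etaPosition`.
[cite: Katz1981CrystallineDieudonne, Thm. 5.3.3 and Thm. 5.1.4] [cite: BerthelotOgus1983, Prop. (3.14)] -/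
theorem isDescendedFrobeniusMatrix_exists_of_katzRankLeTwo
    (hK : Literature.NumberTheory.EllipticCurves.katz_dieudonne_rank_le_two)
    (hη : ∀ (W : WeierstrassCurve ℚ) (𝓜 : W.NineGoodModel) (ρ : ONine →+* ZMod 3), (3 : ℤ) ∣ 𝓜.specialFibreTrace ρ →
      (∃ d : ℕ, ∀ n : ℕ, IsIntegral ℤ_[3] ((3 : KNine) ^ d * ((n : KNine) * coeff n 𝓜.classEta))) ∧
      (∃ d' : ℕ, ∀ e : Fin 2 →₀ ℕ, IsIntegral ℤ_[3] ((3 : KNine) ^ d' * MvPowerSeries.coeff e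
        (𝓜.classEta.subst (𝓜.E.map (algebraMap ONine KNine)).formalGroupLaw -
          𝓜.classEta.subst (MvPowerSeries.X 0) - 𝓜.classEta.subst (MvPowerSeries.X 1)))))
    (hηω : ∀ (W : WeierstrassCurve ℚ) (𝓜 : W.NineGoodModel) (ρ : ONine →+* ZMod 3), (3 : ℤ) ∣ 𝓜.specialFibreTrace ρ →
      ∀ c : KNine, ¬ HasBoundedDenominators (𝓜.classEta - PowerSeries.C c * 𝓜.classOmega)) :
    WeierstrassCurve.isDescendedFrobeniusMatrix_exists := by
  -- model transport (cycu-p4 g8)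
  have hT : ∀ (W : WeierstrassCurve ℚ) (𝓜₁ 𝓜₂ : W.NineGoodModel) (c d : KNine),
      HasBoundedDenominators (expand 3 (by norm_num) 𝓜₂.classOmega - PowerSeries.C c * 𝓜₂.classOmega -
        PowerSeries.C d * 𝓜₂.classEta) →
      HasBoundedDenominators (expand 3 (by norm_num) 𝓜₁.classOmega - PowerSeries.C c * 𝓜₁.classOmega -
        PowerSeries.C d * 𝓜₁.classEta) := fun W 𝓜₁ 𝓜₂ c d h => by
    simpa using (hbd_omegaColumn_iff 𝓜₂ 𝓜₁ 1 c d).mp (by simpa using h)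
  refine isDescendedFrobeniusMatrix_exists_of_etaPosition hT fun W 𝓜 ρ hss => ?_
  set Ω := 𝓜.classOmega with hΩ
  set H := 𝓜.classEta with hH
  -- the three second-kind classes
  have hunit : IsUnit (𝓜.E.map ρ).Δ := by rw [WeierstrassCurve.map_Δ]; exact 𝓜.isUnit_Δ.map ρ
  have hηc0 : constantCoeff H = 0 := by
    rw [hH, WeierstrassCurve.NineGoodModel.classEta, map_add, smul_eq_C_mul, smul_eq_C_mul, map_mul, map_mul,
      WeierstrassCurve.constantCoeff_formalEtaIntegral, WeierstrassCurve.constantCoeff_formalLog, mul_zero, mul_zero,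
      add_zero]
  obtain ⟨hηd, hηd'⟩ := hη W 𝓜 ρ hss
  let f : Fin 3 → KNine⟦X⟧ := ![Ω, expand 3 (by norm_num) Ω, H]
  have hf : ∀ i, constantCoeff (f i) = 0 ∧
      (∃ d : ℕ, ∀ n : ℕ, IsIntegral ℤ_[3] ((3 : KNine) ^ d * ((n : KNine) * coeff n (f i)))) ∧
      (∃ d' : ℕ, ∀ e : Fin 2 →₀ ℕ, IsIntegral ℤ_[3] ((3 : KNine) ^ d' * MvPowerSeries.coeff e
        ((f i).subst (𝓜.E.map (algebraMap ONine KNine)).formalGroupLaw - (f i).subst (MvPowerSeries.X 0) -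
          (f i).subst (MvPowerSeries.X 1)))) := by
    intro i
    fin_cases i
    · exact secondKind_classOmega 𝓜
    · exact secondKind_expand_classOmega 𝓜 ρ
    · exact ⟨hηc0, hηd, hηd'⟩
  obtain ⟨a, ha, hdep⟩ := hK 𝓜.E ρ hunit f hf
  rw [Fin.sum_univ_three] at hdep
  change HasBoundedDenominators (PowerSeries.C (a 0) * Ω + PowerSeries.C (a 1) * expand 3 (by norm_num) Ω +
    PowerSeries.C (a 2) * H) at hdep
  -- the `η`-coefficient is non-zero: otherwise `([ω], φ[ω])` would be dependent
  have ha2 : a 2 ≠ 0 := by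
    intro h2
    rw [h2, map_zero, zero_mul, add_zero] at hdep
    obtain ⟨h0, h1⟩ := omegaPlane_independent 𝓜 ρ hss (hT W) (a 0) (a 1) hdep
    apply ha
    ext i
    fin_cases i
    · exact h0
    · exact h1
    · exact h2
  -- normalise: `η ≡ A ω + B φω`
  set A : KNine := -(a 0 * (a 2)⁻¹) with hA
  set B : KNine := -(a 1 * (a 2)⁻¹) with hB
  have hpos : HasBoundedDenominators (H - PowerSeries.C A * Ω - PowerSeries.C B * expand 3 (by norm_num) Ω) := by
    have h := hbd_C_mul (a 2)⁻¹ hdep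
    have e : PowerSeries.C (a 2)⁻¹ * (PowerSeries.C (a 0) * Ω + PowerSeries.C (a 1) * expand 3 (by norm_num) Ω +
        PowerSeries.C (a 2) * H) = H - PowerSeries.C A * Ω - PowerSeries.C B * expand 3 (by norm_num) Ω := by
      rw [hA, hB, map_neg, map_neg, map_mul, map_mul]
      linear_combination H * C_mul_C_inv ha2
    rwa [e] at h
  have hBne : B ≠ 0 := by
    intro hB0
    rw [hB0, map_zero, zero_mul, sub_zero] at hpos
    exact hηω W 𝓜 ρ hss A hpos
  exact ⟨A, B, hBne, hpos⟩

/-! ### Appendix (lead ruling for the elementary route W1–W5): only SUPERSINGULAR fibres are ever consumed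

The capstone applies the rank statement only on good models with `3 ∣ a` (`a` = trace of the special fibre). The door
below takes the rank statement RESTRICTED to Weierstrass equations over `𝓞` whose special fibre has `3 ∣ HasseManin.tr`,
so that an elementary proof (Honda functional equation + `End_{𝔽₃}(Ê ⊗ 𝔽₃) = ℤ₃[π]` with `π² = [a]π − [3]`,
`3 ∣ a` ⟹ `π² ∈ [3]∘End`, digit expansion 3-adically convergent) may skip the ordinary branch entirely. -/

/-- **The supersingular-only rank statement** (the hypothesis of the door below, weaker than
`Literature.NumberTheory.EllipticCurves.katz_dieudonne_rank_le_two`): for a Weierstrass equation `E/𝓞` with elliptic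
special fibre of trace divisible by `3`, any three second-kind series are `ℚ₃(ζ₉)`-dependent modulo bounded denominators.
[cite: Katz1981CrystallineDieudonne, Thm. 5.3.3] -/
theorem katzRankLeTwo_supersingular_of_katzRankLeTwo
    (hK : Literature.NumberTheory.EllipticCurves.katz_dieudonne_rank_le_two) :
    ∀ (E : WeierstrassCurve ONine) (ρ : ONine →+* ZMod 3), IsUnit (E.map ρ).Δ →
      (3 : ℤ) ∣ Literature.NumberTheory.EllipticCurves.HasseManin.tr (E.map ρ) →
      ∀ f : Fin 3 → KNine⟦X⟧,
        (∀ i, constantCoeff (f i) = 0 ∧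
          (∃ d : ℕ, ∀ n : ℕ, IsIntegral ℤ_[3] ((3 : KNine) ^ d * ((n : KNine) * coeff n (f i)))) ∧
          (∃ d' : ℕ, ∀ e : Fin 2 →₀ ℕ, IsIntegral ℤ_[3] ((3 : KNine) ^ d' * MvPowerSeries.coeff e
            ((f i).subst (E.map (algebraMap ONine KNine)).formalGroupLaw - (f i).subst (MvPowerSeries.X 0) -
              (f i).subst (MvPowerSeries.X 1))))) →
        ∃ a : Fin 3 → KNine, a ≠ 0 ∧ HasBoundedDenominators (∑ i, PowerSeries.C (a i) * f i) :=
  fun E ρ hΔ _ f hf => hK E ρ hΔ f hf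

/-- **`isDescendedFrobeniusMatrix_exists` FROM THE SUPERSINGULAR-ONLY RANK STATEMENT.** Same composition as
`isDescendedFrobeniusMatrix_exists_of_katzRankLeTwo`, but the rank statement is asked only for Weierstrass equations over
`𝓞` whose (elliptic) special fibre has trace divisible by `3` — the only case the descended-Frobenius programme meets
(`3 ∣ 𝓜.specialFibreTrace ρ`, and `HasseManin.tr (𝓜.E ⊗_ρ 𝔽₃) = 𝓜.specialFibreTrace ρ` by
`NineHonda.tr_specialFibre_eq`). With (i) `classEta` of the second kind and (ii) `classEta ∉ ℚ₃(ζ₉)·classOmega`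
modulo bounded denominators on such models, the named fact follows.
[cite: Katz1981CrystallineDieudonne, Thm. 5.3.3 and Thm. 5.1.4] [cite: BerthelotOgus1983, Prop. (3.14)] -/
theorem isDescendedFrobeniusMatrix_exists_of_katzRankLeTwo_supersingular
    (hK : ∀ (E : WeierstrassCurve ONine) (ρ : ONine →+* ZMod 3), IsUnit (E.map ρ).Δ →
      (3 : ℤ) ∣ Literature.NumberTheory.EllipticCurves.HasseManin.tr (E.map ρ) →
      ∀ f : Fin 3 → KNine⟦X⟧,
        (∀ i, constantCoeff (f i) = 0 ∧
          (∃ d : ℕ, ∀ n : ℕ, IsIntegral ℤ_[3] ((3 : KNine) ^ d * ((n : KNine) * coeff n (f i)))) ∧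
          (∃ d' : ℕ, ∀ e : Fin 2 →₀ ℕ, IsIntegral ℤ_[3] ((3 : KNine) ^ d' * MvPowerSeries.coeff e
            ((f i).subst (E.map (algebraMap ONine KNine)).formalGroupLaw - (f i).subst (MvPowerSeries.X 0) -
              (f i).subst (MvPowerSeries.X 1))))) →
        ∃ a : Fin 3 → KNine, a ≠ 0 ∧ HasBoundedDenominators (∑ i, PowerSeries.C (a i) * f i))
    (hη : ∀ (W : WeierstrassCurve ℚ) (𝓜 : W.NineGoodModel) (ρ : ONine →+* ZMod 3), (3 : ℤ) ∣ 𝓜.specialFibreTrace ρ →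
      (∃ d : ℕ, ∀ n : ℕ, IsIntegral ℤ_[3] ((3 : KNine) ^ d * ((n : KNine) * coeff n 𝓜.classEta))) ∧
      (∃ d' : ℕ, ∀ e : Fin 2 →₀ ℕ, IsIntegral ℤ_[3] ((3 : KNine) ^ d' * MvPowerSeries.coeff e
        (𝓜.classEta.subst (𝓜.E.map (algebraMap ONine KNine)).formalGroupLaw -
          𝓜.classEta.subst (MvPowerSeries.X 0) - 𝓜.classEta.subst (MvPowerSeries.X 1)))))
    (hηω : ∀ (W : WeierstrassCurve ℚ) (𝓜 : W.NineGoodModel) (ρ : ONine →+* ZMod 3), (3 : ℤ) ∣ 𝓜.specialFibreTrace ρ →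
      ∀ c : KNine, ¬ HasBoundedDenominators (𝓜.classEta - PowerSeries.C c * 𝓜.classOmega)) :
    WeierstrassCurve.isDescendedFrobeniusMatrix_exists := by
  -- model transport (cycu-p4 g8)
  have hT : ∀ (W : WeierstrassCurve ℚ) (𝓜₁ 𝓜₂ : W.NineGoodModel) (c d : KNine),
      HasBoundedDenominators (expand 3 (by norm_num) 𝓜₂.classOmega - PowerSeries.C c * 𝓜₂.classOmega -
        PowerSeries.C d * 𝓜₂.classEta) →
      HasBoundedDenominators (expand 3 (by norm_num) 𝓜₁.classOmega - PowerSeries.C c * 𝓜₁.classOmega -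
        PowerSeries.C d * 𝓜₁.classEta) := fun W 𝓜₁ 𝓜₂ c d h => by
    simpa using (hbd_omegaColumn_iff 𝓜₂ 𝓜₁ 1 c d).mp (by simpa using h)
  refine isDescendedFrobeniusMatrix_exists_of_etaPosition hT fun W 𝓜 ρ hss => ?_
  set Ω := 𝓜.classOmega with hΩ
  set H := 𝓜.classEta with hH
  have hunit : IsUnit (𝓜.E.map ρ).Δ := by rw [WeierstrassCurve.map_Δ]; exact 𝓜.isUnit_Δ.map ρ
  have htr : (3 : ℤ) ∣ Literature.NumberTheory.EllipticCurves.HasseManin.tr (𝓜.E.map ρ) := by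
    rwa [NineHonda.tr_specialFibre_eq 𝓜 ρ]
  have hηc0 : constantCoeff H = 0 := by
    rw [hH, WeierstrassCurve.NineGoodModel.classEta, map_add, smul_eq_C_mul, smul_eq_C_mul, map_mul, map_mul,
      WeierstrassCurve.constantCoeff_formalEtaIntegral, WeierstrassCurve.constantCoeff_formalLog, mul_zero, mul_zero,
      add_zero]
  obtain ⟨hηd, hηd'⟩ := hη W 𝓜 ρ hss
  let f : Fin 3 → KNine⟦X⟧ := ![Ω, expand 3 (by norm_num) Ω, H]
  have hf : ∀ i, constantCoeff (f i) = 0 ∧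
      (∃ d : ℕ, ∀ n : ℕ, IsIntegral ℤ_[3] ((3 : KNine) ^ d * ((n : KNine) * coeff n (f i)))) ∧
      (∃ d' : ℕ, ∀ e : Fin 2 →₀ ℕ, IsIntegral ℤ_[3] ((3 : KNine) ^ d' * MvPowerSeries.coeff e
        ((f i).subst (𝓜.E.map (algebraMap ONine KNine)).formalGroupLaw - (f i).subst (MvPowerSeries.X 0) -
          (f i).subst (MvPowerSeries.X 1)))) := by
    intro i
    fin_cases i
    · exact secondKind_classOmega 𝓜
    · exact secondKind_expand_classOmega 𝓜 ρ
    · exact ⟨hηc0, hηd, hηd'⟩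
  obtain ⟨a, ha, hdep⟩ := hK 𝓜.E ρ hunit htr f hf
  rw [Fin.sum_univ_three] at hdep
  change HasBoundedDenominators (PowerSeries.C (a 0) * Ω + PowerSeries.C (a 1) * expand 3 (by norm_num) Ω +
    PowerSeries.C (a 2) * H) at hdep
  -- the `η`-coefficient is non-zero: otherwise `([ω], φ[ω])` would be dependent
  have ha2 : a 2 ≠ 0 := by
    intro h2
    rw [h2, map_zero, zero_mul, add_zero] at hdep
    obtain ⟨h0, h1⟩ := omegaPlane_independent 𝓜 ρ hss (hT W) (a 0) (a 1) hdep
    apply ha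
    ext i
    fin_cases i
    · exact h0
    · exact h1
    · exact h2
  -- normalise: `η ≡ A ω + B φω`
  set A : KNine := -(a 0 * (a 2)⁻¹) with hA
  set B : KNine := -(a 1 * (a 2)⁻¹) with hB
  have hpos : HasBoundedDenominators (H - PowerSeries.C A * Ω - PowerSeries.C B * expand 3 (by norm_num) Ω) := by
    have h := hbd_C_mul (a 2)⁻¹ hdep
    have e : PowerSeries.C (a 2)⁻¹ * (PowerSeries.C (a 0) * Ω + PowerSeries.C (a 1) * expand 3 (by norm_num) Ω +
        PowerSeries.C (a 2) * H) = H - PowerSeries.C A * Ω - PowerSeries.C B * expand 3 (by norm_num) Ω := by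
      rw [hA, hB, map_neg, map_neg, map_mul, map_mul]
      linear_combination H * C_mul_C_inv ha2
    rwa [e] at h
  have hBne : B ≠ 0 := by
    intro hB0
    rw [hB0, map_zero, zero_mul, sub_zero] at hpos
    exact hηω W 𝓜 ρ hss A hpos
  exact ⟨A, B, hBne, hpos⟩

end Summit.BirchSwinnertonDyer.BirchSwinnertonDyer.Theorems.NineNamedFactOfKatzRank

end
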